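import Summits.BirchSwinnertonDyer.BirchSwinnertonDyer.Theorems.ByReductionTypeAtTwoFineSelmerConjAAtTwoAdditivePotGoodMinkowskiDoor
import HarnessLib

/-!
# Route `ByReductionTypeAtTwo` (rung K4), crux C1″ `FineSelmerConjAAtTwoAdditivePotGood` (item stmt-BirchSwinnertonDyer-22615):
# PRESENTATION TRANSPORT for the unique-prime doors — shifting/scaling the `2`-division cubic keeps the point field `ℚ(P)`, so the
# inert / Eisenstein / Minkowski doors apply to a cubic model `y² = x³ + px² + qx + r` in ANY integral presentation `x ↦ x + t`
# (a `--supports 22615` file; seat `bsd-2adic-k4-w1` GEN 4; serves the per-row stamps of the census (pen RC-350 / kit-2 (c)))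

HONEST FRAMING (cell `bsd-2adic`, D-0036/D-0054): types-the-object-of; closes nothing at the `∀`-level; nothing booked; BSD is not
proved by any of this. §1 is unconditional algebra; §2–§3 are conditional on `hLim2` (Lim 2017 Thm. 3.5 at `2`) BY NAME and on at most
ONE displayed bit `2 ∤ #Cl(𝓞 ℚ(β))` (none in §3).

WHY. The census rows of K4's additive block are cubic models `W = ⟨0, a₂, 0, a₄, a₆⟩`, i.e. `y² = x³ + px² + qx + r` with `p q r ∈ ℤ`,
and the `2`-torsion point `(β, 0)` has point field `ℚ(β)` (`…CubicRealization`). The parity criteria of `…InertDoor` (`r` odd, `p + q`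
odd) and `…EisensteinDoor` (`p, q, r` even, `4 ∤ r`) are properties of the PRESENTATION, while «one prime above `2`» is a property of
the FIELD: when the native cubic fails the test, a translate `β + t` (root of `f(X − t)`) may pass it, and `ℚ(β + t) = ℚ(β)`.

* §1 `aeval_cubic_shift` / `adjoin_shift_eq` (`β ↦ β + t`: `(p, q, r) ↦ (p − 3t, 3t² − 2pt + q, r − qt + pt² − t³)`, same field, same
  discriminant `cubic_discr_shift`), `aeval_cubic_scale` / `adjoin_scale_eq` (`β ↦ uβ`: `(p, q, r) ↦ (pu, qu², ru³)`, `u ≠ 0`).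
* §2 doors for `W = ⟨0, p, 0, q, r⟩` through a shifted presentation, ONE bit displayed:
  `fineSelmerDual_moduleFinite_two_cubicModel_of_odd_shift` (shifted cubic has `r'` odd, `p' + q'` odd),
  `fineSelmerDual_moduleFinite_two_cubicModel_of_eisenstein_shift` (shifted cubic Eisenstein at `2`).
* §3 the same with NO bit when `|disc| ≤ 108` (`…_of_odd_shift_of_abs_discr_le`, `…_of_eisenstein_two_shift_of_abs_discr_le`), e.g.
  `conjA_two_cubicModel_disc_neg44'` for the NATIVE model `y² = x³ − x² + x + 1` of the `d = −44` field (shift `t = −1` makes it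
  Eisenstein: `X³ + 2X² + 2X + 2`).

References: [Lim2017FineSelmer] Thm. 3.5, Lemma 3.2; [CoatesSujatha2005] (A); [Greenberg2001IwasawaPastPresent] Prop. 2.1;
[Cohen1993] §4.4 (Tschirnhaus transformations), App. B Table B.4.
-/

set_option autoImplicit false
-- sibling precedent (`…MinkowskiDoor.lean`): the directory name repeats the summit name
set_option linter.dupNamespace false

noncomputable section

open scoped Classical IntermediateField NumberField

namespace Summit.BirchSwinnertonDyer.BirchSwinnertonDyer.Theorems.AddKatoTwo

open WeierstrassCurve Field Polynomial IsDedekindDomain Literature.NumberTheory.EllipticCurves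
  Literature.NumberTheory.GaloisRepresentations
  Literature.NumberTheory.IwasawaTheory
  Summit.BirchSwinnertonDyer.BirchSwinnertonDyer.Theorems.AlignedTransportAtTwoTorsionPointField
  Summit.BirchSwinnertonDyer.BirchSwinnertonDyer.Theses.ByReductionTypeAtTwo

/-! ## §1 Shift and scale of a cubic presentation -/

section Transport

/-- **Shift**: if `β` is a root of `X³ + pX² + qX + r` then `β + t` is a root of
`X³ + (p − 3t)X² + (3t² − 2pt + q)X + (r − qt + pt² − t³)` (`= f(X − t)`). [folklore] -/
theorem aeval_cubic_shift {p q r : ℚ} (t : ℚ) {β : AlgebraicClosure ℚ} (hβ : aeval β (Cubic.toPoly ⟨1, p, q, r⟩) = 0) :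
    aeval (β + algebraMap ℚ (AlgebraicClosure ℚ) t)
      (Cubic.toPoly ⟨1, p - 3 * t, 3 * t ^ 2 - 2 * p * t + q, r - q * t + p * t ^ 2 - t ^ 3⟩) = 0 := by
  simp only [Cubic.toPoly, map_one, one_mul, aeval_C, aeval_X, map_sub, map_mul, map_pow, map_add, map_ofNat] at hβ ⊢
  linear_combination hβ

/-- The shifted presentation has the same discriminant. [folklore] -/
theorem cubic_discr_shift (p q r t : ℚ) :
    Cubic.discr ⟨1, p - 3 * t, 3 * t ^ 2 - 2 * p * t + q, r - q * t + p * t ^ 2 - t ^ 3⟩ = Cubic.discr ⟨1, p, q, r⟩ := by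
  simp only [Cubic.discr]; ring

/-- **Same field**: `ℚ(β + t) = ℚ(β)` for `t ∈ ℚ`. [folklore] -/
theorem adjoin_shift_eq (t : ℚ) (β : AlgebraicClosure ℚ) :
    IntermediateField.adjoin ℚ {β + algebraMap ℚ (AlgebraicClosure ℚ) t} = IntermediateField.adjoin ℚ {β} := by
  apply le_antisymm
  · rw [IntermediateField.adjoin_simple_le_iff]
    exact add_mem (IntermediateField.mem_adjoin_simple_self ℚ β) (algebraMap_mem _ _)
  · rw [IntermediateField.adjoin_simple_le_iff]
    have h1 := IntermediateField.mem_adjoin_simple_self ℚ (β + algebraMap ℚ (AlgebraicClosure ℚ) t)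
    have h2 : algebraMap ℚ (AlgebraicClosure ℚ) t ∈
        IntermediateField.adjoin ℚ {β + algebraMap ℚ (AlgebraicClosure ℚ) t} := algebraMap_mem _ _
    convert sub_mem h1 h2 using 1
    ring

/-- **Scale**: if `β` is a root of `X³ + pX² + qX + r` then `uβ` is a root of `X³ + puX² + qu²X + ru³`. [folklore] -/
theorem aeval_cubic_scale {p q r : ℚ} (u : ℚ) {β : AlgebraicClosure ℚ} (hβ : aeval β (Cubic.toPoly ⟨1, p, q, r⟩) = 0) :
    aeval (algebraMap ℚ (AlgebraicClosure ℚ) u * β) (Cubic.toPoly ⟨1, p * u, q * u ^ 2, r * u ^ 3⟩) = 0 := by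
  simp only [Cubic.toPoly, map_one, one_mul, aeval_C, aeval_X, map_mul, map_pow, map_add] at hβ ⊢
  linear_combination (algebraMap ℚ (AlgebraicClosure ℚ) u) ^ 3 * hβ

/-- **Same field**: `ℚ(uβ) = ℚ(β)` for `u ∈ ℚˣ`. [folklore] -/
theorem adjoin_scale_eq {u : ℚ} (hu : u ≠ 0) (β : AlgebraicClosure ℚ) :
    IntermediateField.adjoin ℚ {algebraMap ℚ (AlgebraicClosure ℚ) u * β} = IntermediateField.adjoin ℚ {β} := by
  apply le_antisymm
  · rw [IntermediateField.adjoin_simple_le_iff]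
    exact mul_mem (algebraMap_mem _ _) (IntermediateField.mem_adjoin_simple_self ℚ β)
  · rw [IntermediateField.adjoin_simple_le_iff]
    have h1 := IntermediateField.mem_adjoin_simple_self ℚ (algebraMap ℚ (AlgebraicClosure ℚ) u * β)
    have h2 : algebraMap ℚ (AlgebraicClosure ℚ) u⁻¹ ∈
        IntermediateField.adjoin ℚ {algebraMap ℚ (AlgebraicClosure ℚ) u * β} := algebraMap_mem _ _
    convert mul_mem h2 h1 using 1
    rw [← mul_assoc, ← map_mul, inv_mul_cancel₀ hu, map_one, one_mul]

/-- The integer shift, in the integer currency of the doors: if `β` is a root of `X³ + pX² + qX + r` (`p q r : ℤ`) then `β + t`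
(`t : ℤ`) is a root of the integer cubic with coefficients `(p − 3t, 3t² − 2pt + q, r − qt + pt² − t³)`. [folklore] -/
theorem aeval_cubic_shift_int {p q r : ℤ} (t : ℤ) {β : AlgebraicClosure ℚ}
    (hβ : aeval β (Cubic.toPoly ⟨1, (p : ℚ), q, r⟩) = 0) :
    aeval (β + algebraMap ℚ (AlgebraicClosure ℚ) t)
      (Cubic.toPoly ⟨1, ((p - 3 * t : ℤ) : ℚ), ((3 * t ^ 2 - 2 * p * t + q : ℤ) : ℚ),
        ((r - q * t + p * t ^ 2 - t ^ 3 : ℤ) : ℚ)⟩) = 0 := by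
  have := aeval_cubic_shift (t : ℚ) hβ
  push_cast at this ⊢
  exact this

end Transport

/-! ## §2 Doors for the cubic model through a shifted presentation (ONE bit displayed) -/

section ShiftedDoors

variable {p q r : ℤ}

/-- **(A)₂ for `y² = x³ + px² + qx + r` through a SHIFTED INERT presentation** (granted `hLim2` BY NAME): if for some `t : ℤ` the
translate `f(X − t)` has odd constant term and odd `p' + q'` (so `2` is inert in `ℚ(β) = ℚ(β + t)`, kernel) and `2 ∤ #Cl(𝓞 ℚ(β))`,
then statement (A)₂ holds for the cubic model. [cite: Lim2017FineSelmer, §3 Thm. 3.5 and Lemma 3.2]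
[cite: Greenberg2001IwasawaPastPresent, Prop. 2.1 p. 339] [cite: CoatesSujatha2005, §3 statement (A)] -/
theorem fineSelmerDual_moduleFinite_two_cubicModel_of_odd_shift
    (hLim2 : Lim2017.thm35_at_two_fineSelmerDual_moduleFinite_of_classicalMuVanishes_of_le_divisionField_four)
    [(⟨0, (p : ℚ), 0, q, r⟩ : WeierstrassCurve ℚ).IsElliptic] (t : ℤ)
    (hr : Odd (r - q * t + p * t ^ 2 - t ^ 3)) (hpq : Odd ((p - 3 * t) + (3 * t ^ 2 - 2 * p * t + q)))
    {β : AlgebraicClosure ℚ} (hβ : aeval β (Cubic.toPoly ⟨1, (p : ℚ), q, r⟩) = 0)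
    (hh : ¬ 2 ∣ Nat.card (ClassGroup (𝓞 (IntermediateField.adjoin ℚ {β}))))
    (κ : ZpExtension ℚ 2) (hκ : κ.IsCyclotomic) :
    ∃ (γ : absoluteGaloisGroup ℚ) (D : (⟨0, (p : ℚ), 0, q, r⟩ : WeierstrassCurve ℚ).FineSelmerDualData κ γ),
      Module.Finite ℤ_[2] (RestrictScalars ℤ_[2] (IwasawaAlgebra 2) D.X) := by
  obtain ⟨P₀, hP₀, hP₀eq⟩ := exists_geomTorsion_two_eq_some_root (p : ℚ) q r hβ
  have hF : IntermediateField.fixedField (MulAction.stabilizer (absoluteGaloisGroup ℚ) P₀) =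
      IntermediateField.adjoin ℚ {β + algebraMap ℚ (AlgebraicClosure ℚ) t} := by
    rw [fixedField_stabilizer_eq_adjoin_root (p : ℚ) q r hβ hP₀eq, adjoin_shift_eq]
    -- the two `Algebra ℚ ℚ̄` instance paths (`AlgebraicClosure.instAlgebra` / `DivisionRing.toRatAlgebra`) agree
    congr 1
  have hh' : ¬ 2 ∣ Nat.card (ClassGroup (𝓞 (IntermediateField.adjoin ℚ {β + algebraMap ℚ (AlgebraicClosure ℚ) t}))) := by
    rw [adjoin_shift_eq]; exact hh
  exact fineSelmerDual_moduleFinite_two_of_odd_cubic_pointField hLim2 _ hP₀ hr hpq (aeval_cubic_shift_int t hβ) hF hh' κ hκ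

/-- **(A)₂ for `y² = x³ + px² + qx + r` through a SHIFTED EISENSTEIN presentation** (granted `hLim2`): if for some `t : ℤ` the translate
`f(X − t)` is Eisenstein at `2` (`p', q', r'` even, `4 ∤ r'`; so `2 = 𝔭³` in `ℚ(β)`, kernel) and `2 ∤ #Cl(𝓞 ℚ(β))`, then (A)₂ holds for the
cubic model. [cite: Lim2017FineSelmer, §3 Thm. 3.5 and Lemma 3.2] [cite: Greenberg2001IwasawaPastPresent, Prop. 2.1 p. 339] -/
theorem fineSelmerDual_moduleFinite_two_cubicModel_of_eisenstein_shift
    (hLim2 : Lim2017.thm35_at_two_fineSelmerDual_moduleFinite_of_classicalMuVanishes_of_le_divisionField_four)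
    [(⟨0, (p : ℚ), 0, q, r⟩ : WeierstrassCurve ℚ).IsElliptic] (t : ℤ)
    (hp : Even (p - 3 * t)) (hq : Even (3 * t ^ 2 - 2 * p * t + q)) (hr : Even (r - q * t + p * t ^ 2 - t ^ 3))
    (hr4 : ¬ (4 : ℤ) ∣ (r - q * t + p * t ^ 2 - t ^ 3))
    {β : AlgebraicClosure ℚ} (hβ : aeval β (Cubic.toPoly ⟨1, (p : ℚ), q, r⟩) = 0)
    (hh : ¬ 2 ∣ Nat.card (ClassGroup (𝓞 (IntermediateField.adjoin ℚ {β}))))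
    (κ : ZpExtension ℚ 2) (hκ : κ.IsCyclotomic) :
    ∃ (γ : absoluteGaloisGroup ℚ) (D : (⟨0, (p : ℚ), 0, q, r⟩ : WeierstrassCurve ℚ).FineSelmerDualData κ γ),
      Module.Finite ℤ_[2] (RestrictScalars ℤ_[2] (IwasawaAlgebra 2) D.X) := by
  obtain ⟨P₀, hP₀, hP₀eq⟩ := exists_geomTorsion_two_eq_some_root (p : ℚ) q r hβ
  have hF : IntermediateField.fixedField (MulAction.stabilizer (absoluteGaloisGroup ℚ) P₀) =
      IntermediateField.adjoin ℚ {β + algebraMap ℚ (AlgebraicClosure ℚ) t} := by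
    rw [fixedField_stabilizer_eq_adjoin_root (p : ℚ) q r hβ hP₀eq, adjoin_shift_eq]
    -- the two `Algebra ℚ ℚ̄` instance paths (`AlgebraicClosure.instAlgebra` / `DivisionRing.toRatAlgebra`) agree
    congr 1
  have hh' : ¬ 2 ∣ Nat.card (ClassGroup (𝓞 (IntermediateField.adjoin ℚ {β + algebraMap ℚ (AlgebraicClosure ℚ) t}))) := by
    rw [adjoin_shift_eq]; exact hh
  exact fineSelmerDual_moduleFinite_two_of_eisenstein_pointField hLim2 _ hP₀ hp hq hr hr4 (aeval_cubic_shift_int t hβ) hF hh'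
    κ hκ

end ShiftedDoors

/-! ## §3 The same with NO bit displayed when `|disc| ≤ 108` -/

section ShiftedSmall

variable {p q r : ℤ}

/-- The integer shift preserves the discriminant. [folklore] -/
theorem cubic_discr_shift_int (p q r t : ℤ) :
    Cubic.discr ⟨1, p - 3 * t, 3 * t ^ 2 - 2 * p * t + q, r - q * t + p * t ^ 2 - t ^ 3⟩ = Cubic.discr ⟨1, p, q, r⟩ := by
  simp only [Cubic.discr]; ring

/-- **(A)₂ for `y² = x³ + px² + qx + r`, NO datum, through a shifted inert presentation with `|disc| ≤ 108`** (granted `hLim2` only):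
the shifted field has `h = 1` by `…MinkowskiDoor`. [cite: Lim2017FineSelmer, §3 Thm. 3.5 and Lemma 3.2] [cite: Marcus1977, Ch. 5 Cor. 2 of Thm. 37] -/
theorem fineSelmerDual_moduleFinite_two_cubicModel_of_odd_shift_of_abs_discr_le
    (hLim2 : Lim2017.thm35_at_two_fineSelmerDual_moduleFinite_of_classicalMuVanishes_of_le_divisionField_four)
    [(⟨0, (p : ℚ), 0, q, r⟩ : WeierstrassCurve ℚ).IsElliptic] (t : ℤ)
    (hr : Odd (r - q * t + p * t ^ 2 - t ^ 3)) (hpq : Odd ((p - 3 * t) + (3 * t ^ 2 - 2 * p * t + q)))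
    (hsmall : |Cubic.discr ⟨1, p, q, r⟩| ≤ 108)
    {β : AlgebraicClosure ℚ} (hβ : aeval β (Cubic.toPoly ⟨1, (p : ℚ), q, r⟩) = 0)
    (κ : ZpExtension ℚ 2) (hκ : κ.IsCyclotomic) :
    ∃ (γ : absoluteGaloisGroup ℚ) (D : (⟨0, (p : ℚ), 0, q, r⟩ : WeierstrassCurve ℚ).FineSelmerDualData κ γ),
      Module.Finite ℤ_[2] (RestrictScalars ℤ_[2] (IwasawaAlgebra 2) D.X) := by
  refine fineSelmerDual_moduleFinite_two_cubicModel_of_odd_shift hLim2 t hr hpq hβ ?_ κ hκ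
  rw [← adjoin_shift_eq (t : ℚ) β,
    card_classGroup_adjoin_eq_one_of_odd_of_abs_discr_le hr hpq (by rwa [cubic_discr_shift_int]) (aeval_cubic_shift_int t hβ)]
  norm_num

/-- **(A)₂ for `y² = x³ + px² + qx + r`, NO datum, through a shifted Eisenstein presentation with constant term `±2` and `|disc| ≤ 108`**
(granted `hLim2` only). [cite: Lim2017FineSelmer, §3 Thm. 3.5 and Lemma 3.2] [cite: Marcus1977, Ch. 5 Thm. 37 and Cor. 2] -/
theorem fineSelmerDual_moduleFinite_two_cubicModel_of_eisenstein_two_shift_of_abs_discr_le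
    (hLim2 : Lim2017.thm35_at_two_fineSelmerDual_moduleFinite_of_classicalMuVanishes_of_le_divisionField_four)
    [(⟨0, (p : ℚ), 0, q, r⟩ : WeierstrassCurve ℚ).IsElliptic] (t : ℤ)
    (hp : Even (p - 3 * t)) (hq : Even (3 * t ^ 2 - 2 * p * t + q))
    (hr2 : r - q * t + p * t ^ 2 - t ^ 3 = 2 ∨ r - q * t + p * t ^ 2 - t ^ 3 = -2)
    (hsmall : |Cubic.discr ⟨1, p, q, r⟩| ≤ 108)
    {β : AlgebraicClosure ℚ} (hβ : aeval β (Cubic.toPoly ⟨1, (p : ℚ), q, r⟩) = 0)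
    (κ : ZpExtension ℚ 2) (hκ : κ.IsCyclotomic) :
    ∃ (γ : absoluteGaloisGroup ℚ) (D : (⟨0, (p : ℚ), 0, q, r⟩ : WeierstrassCurve ℚ).FineSelmerDualData κ γ),
      Module.Finite ℤ_[2] (RestrictScalars ℤ_[2] (IwasawaAlgebra 2) D.X) := by
  have hr : Even (r - q * t + p * t ^ 2 - t ^ 3) := by rcases hr2 with h | h <;> rw [h] <;> decide
  have hr4 : ¬ (4 : ℤ) ∣ (r - q * t + p * t ^ 2 - t ^ 3) := by rcases hr2 with h | h <;> rw [h] <;> decide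
  refine fineSelmerDual_moduleFinite_two_cubicModel_of_eisenstein_shift hLim2 t hp hq hr hr4 hβ ?_ κ hκ
  rw [← adjoin_shift_eq (t : ℚ) β,
    card_classGroup_adjoin_eq_one_of_eisenstein_two_of_abs_discr_le hp hq hr2 (by rwa [cubic_discr_shift_int])
      (aeval_cubic_shift_int t hβ)]
  norm_num

/-- `y² = x³ − x² + x + 1` (the native model of the `d = −44` field; `2`-division cubic `≡ (X + 1)³ mod 2`) is an elliptic curve. -/
theorem isElliptic_cubicModel_disc_neg44' :
    (⟨0, ((-1 : ℤ) : ℚ), 0, ((1 : ℤ) : ℚ), ((1 : ℤ) : ℚ)⟩ : WeierstrassCurve ℚ).IsElliptic :=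
  isElliptic_cubicModel _ _ _ (by simp only [Cubic.discr]; norm_num)

/-- **Conjecture A at `p = 2` for `y² = x³ − x² + x + 1`, modulo Lim 2017 Thm. 3.5 ALONE** — the native presentation is neither
inert-parity nor Eisenstein, but the shift `t = −1` (`β ↦ β − 1`) gives `X³ + 2X² + 2X + 2` (Eisenstein, constant term `2`, disc `−44`).
[cite: Lim2017FineSelmer, §3 Thm. 3.5 and Lemma 3.2] [cite: CoatesSujatha2005, §3 statement (A)] -/
theorem conjA_two_cubicModel_disc_neg44'
    (hLim2 : Lim2017.thm35_at_two_fineSelmerDual_moduleFinite_of_classicalMuVanishes_of_le_divisionField_four)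
    (κ : ZpExtension ℚ 2) (hκ : κ.IsCyclotomic) :
    haveI := isElliptic_cubicModel_disc_neg44'
    ∃ (γ : absoluteGaloisGroup ℚ)
      (D : (⟨0, ((-1 : ℤ) : ℚ), 0, ((1 : ℤ) : ℚ), ((1 : ℤ) : ℚ)⟩ : WeierstrassCurve ℚ).FineSelmerDualData κ γ),
      Module.Finite ℤ_[2] (RestrictScalars ℤ_[2] (IwasawaAlgebra 2) D.X) := by
  haveI := isElliptic_cubicModel_disc_neg44'
  obtain ⟨β, hβ⟩ : ∃ β : AlgebraicClosure ℚ, aeval β (Cubic.toPoly ⟨1, ((-1 : ℤ) : ℚ), ((1 : ℤ) : ℚ), ((1 : ℤ) : ℚ)⟩) = 0 :=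
    IsAlgClosed.exists_aeval_eq_zero _ _ (by rw [Cubic.degree_of_a_ne_zero one_ne_zero]; norm_num)
  exact fineSelmerDual_moduleFinite_two_cubicModel_of_eisenstein_two_shift_of_abs_discr_le hLim2 (p := -1) (q := 1) (r := 1)
    (-1) (by decide) (by decide) (Or.inl (by decide)) (by simp only [Cubic.discr]; norm_num) hβ κ hκ

end ShiftedSmall

end Summit.BirchSwinnertonDyer.BirchSwinnertonDyer.Theorems.AddKatoTwo

end
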